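import Mathlib
import Literature.NumberTheory.LFunctions.Zhang2022.TypedSection10C
import HarnessLib

/-!
# Zhang (2022) §10c, discharged bookkeeping I: the expansions and the three-window splits of
# `S_j(𝐚₁₄,𝐚₂₂)` and `S_j(𝐚₁₂,𝐚₁₄)` (DAG nodes Z22:§10.u047, u048, u054, u055-split)

Topic `Literature/NumberTheory/LFunctions/Zhang2022` (Landau–Siegel audit tree; verdict-neutral).
Y. Zhang, *Discrete mean estimates and the Landau–Siegel zero*, arXiv:2211.02515v1 (2022)
[Zhang2022LandauSiegel], §10 pp. 59–61 — **an unrefereed manuscript under adjudication; this file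
asserts nothing about its Theorems 1–2.** D-0069 campaign, discharge layer L3 (seat sz-d34): four
proof-step CLAIM nodes of `TypedSection10C` (L3-t8) are PROVED here, unconditionally (no Assumption
(A), every modulus `D`, every real character `χ`), by finite-sum bookkeeping over the skeleton's real
objects — no analytic number theory is involved:

| DAG node | locator | theorem | content |
|---|---|---|---|
| `Z22:§10.u047` | p.59, tex L3018 | `sjExpand1422_holds : SjExpand1422 c′` | `S_j(𝐚₁₄,𝐚₂₂)` (`Skeleton.Sj` of Prop. 7.1 at `Skeleton.a14/a22`) `= Σ_rΣ_d |χ(d)||μχ(r)|λ₀ⱼ(dr)/(drφ(r))(Σ_m …)(Σ_n …)` |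
| `Z22:§10.u048` | p.59, tex L3025 | `split1422_holds : Split1422 c′` | the windows `dr < P^{0.496}`, `P^{0.496} ≤ dr < P^{0.498}`, `P^{0.498} ≤ dr < P^{0.5}` exhaust it |
| `Z22:§10.u054` | p.60, tex L3073 | `sjExpand1214_holds : SjExpand1214 c′` | the same for `S_j(𝐚₁₂,𝐚₁₄)` |
| `Z22:§10.u055` (split) | p.60, tex L3079 | `split1214_holds : Split1214 c′` | "split into three sums in the same way" |

Mechanism. (u047/u054) `χ` is real (`χ.IsQuadratic`, part of the skeleton's standing quantifier
`ForAllLarge`), so in `S_j` the character factors `χ(drm)` of `a₁₄(drm)` (resp. `a₁₂(drm)`) and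
`conj χ(drn)` of `a₂₂(drn) = conj a₁₂(drn)` (resp. `χ(drn)` of `a₁₄(drn)`) factor as
`χ(d)χ(r)χ(m)` and `χ(d)χ(r)χ(n)`, and `|μ(r)|χ(d)²χ(r)² = |χ(d)|·|μ(r)χ(r)|` (`prefactor_eq`); the
order of summation is exchanged (`Finset.sum_comm`). (u048/u055) the weights `ϰ₂`, `ϰ₃` of (8.6)
(`Skeleton.vk2/vk3`) are supported on `k < P₂ = P^{0.5}T^{-10} ≤ P^{0.5}`, `k < P₃ = P^{0.498} ≤ P^{0.5}`,
so every `(d,r)`-term with `dr ≥ P^{0.5}` vanishes through its `n`-sum (`nSum22`) resp. `m`-sum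
(`mSum12`), and for `0 ≤ dr < P^{0.5}` exactly one window indicator is on (`split_three`).

## References

* Y. Zhang, arXiv:2211.02515v1 (2022), §10 pp. 59–61; §7 Prop. 7.1 (`S_j`); §8 (8.6) (`ϰ₂, ϰ₃`);
  §2 (2.21) (`P₂, P₃`). [cite: Zhang2022LandauSiegel, §10 pp. 59–61]
-/

noncomputable section

open Complex Real ComplexConjugate
open Literature.NumberTheory.LFunctions.Zhang2022.Skeleton

namespace Literature.NumberTheory.LFunctions.Zhang2022.Typed.Sec10C

section D34Expand

variable {D : ℕ} (χ : DirichletCharacter ℂ D)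

/-- For a real (quadratic) character, `χ(a)² = |χ(a)|` (the values are `0, ±1`).
[cite: Zhang2022LandauSiegel, §8 p. 47] -/
theorem sq_eq_norm_of_isQuadratic (hq : χ.IsQuadratic) (a : ZMod D) :
    χ a ^ 2 = (‖χ a‖ : ℂ) := by
  rcases hq a with h | h | h <;> simp [h]

/-- For a real (quadratic) character, `conj χ(a) = χ(a)`. [cite: Zhang2022LandauSiegel, §10 p. 53] -/
theorem conj_eq_self_of_isQuadratic (hq : χ.IsQuadratic) (a : ZMod D) : conj (χ a) = χ a := by
  rcases hq a with h | h | h <;> simp [h]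

/-- `|μ(r)|` as a natural number cast to `ℂ` is the norm of `μ(r)`. [folklore] -/
private theorem natAbs_moebius_eq_norm (r : ℕ) :
    ((ArithmeticFunction.moebius r).natAbs : ℂ) = (‖(ArithmeticFunction.moebius r : ℂ)‖ : ℂ) := by
  rw [Complex.norm_intCast]
  norm_cast
  rw [Nat.cast_natAbs]

/-- The arithmetic prefactor of `S_j`: for real `χ`,
`|μ(r)|·χ(d)²·χ(r)² = |χ(d)|·|μ(r)χ(r)|`. [cite: Zhang2022LandauSiegel, §10 p. 57] -/
theorem prefactor_eq (hq : χ.IsQuadratic) (d r : ℕ) :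
    ((ArithmeticFunction.moebius r).natAbs : ℂ) * (χ (d : ZMod D) * χ (r : ZMod D)) *
        (χ (d : ZMod D) * χ (r : ZMod D)) =
      (‖χ (d : ZMod D)‖ : ℂ) * (‖(ArithmeticFunction.moebius r : ℂ) * χ (r : ZMod D)‖ : ℂ) := by
  rw [norm_mul, Complex.ofReal_mul, ← natAbs_moebius_eq_norm, ← sq_eq_norm_of_isQuadratic χ hq,
    ← sq_eq_norm_of_isQuadratic χ hq]
  ring

variable (c' : ℝ)

/-- The `m`-sum of `S_j(𝐚₁₄,·)`: `Σ_m a₁₄(drm)m^{−(1−β_j)} = χ(d)χ(r)·Σ_m χ(m)f̃(…)m^{−(1−β_j)}`.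
[cite: Zhang2022LandauSiegel, §10 p. 59] -/
theorem mSum_a14_eq (j d r : ℕ) :
    ∑ m ∈ Finset.Ico 1 (Nsupp D), a14 χ (d * r * m) / (m : ℂ) ^ (1 - betaJ c' D j) =
      χ (d : ZMod D) * χ (r : ZMod D) * mSum14 c' χ j d r := by
  unfold mSum14 a14
  rw [Finset.mul_sum]
  refine Finset.sum_congr rfl fun m _ => ?_
  push_cast
  rw [map_mul, map_mul]
  ring

/-- The `n`-sum of `S_j(·,𝐚₂₂)` for real `χ`:
`Σ_n a₂₂(drn)ξ₀ⱼ(n;d,r)n⁻¹ = χ(d)χ(r)·Σ_n χ(n)(ι₃ϰ̄₃(drn) + ι₄ϰ̄₂(drn))ξ₀ⱼ(n;d,r)n⁻¹`.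
[cite: Zhang2022LandauSiegel, §10 p. 59] -/
theorem nSum_a22_eq (hq : χ.IsQuadratic) (j d r : ℕ) :
    ∑ n ∈ Finset.Ico 1 (Nsupp D), a22 χ (d * r * n) * xiZero c' D j n d r / (n : ℂ) =
      χ (d : ZMod D) * χ (r : ZMod D) * nSum22 c' χ j d r := by
  unfold nSum22 a22 a12
  rw [Finset.mul_sum]
  refine Finset.sum_congr rfl fun n _ => ?_
  push_cast
  rw [map_mul, map_mul]
  simp only [map_mul, map_add, Complex.conj_conj, conj_eq_self_of_isQuadratic χ hq]
  ring

/-- The `m`-sum of `S_j(𝐚₁₂,·)` :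
`Σ_m a₁₂(drm)m^{−(1−β_j)} = χ(d)χ(r)·Σ_m χ(m)(ῑ₃ϰ₃(drm) + ῑ₄ϰ₂(drm))m^{−(1−β_j)}`.
[cite: Zhang2022LandauSiegel, §10 p. 60] -/
theorem mSum_a12_eq (j d r : ℕ) :
    ∑ m ∈ Finset.Ico 1 (Nsupp D), a12 χ (d * r * m) / (m : ℂ) ^ (1 - betaJ c' D j) =
      χ (d : ZMod D) * χ (r : ZMod D) * mSum12 c' χ j d r := by
  unfold mSum12 a12
  rw [Finset.mul_sum]
  refine Finset.sum_congr rfl fun m _ => ?_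
  push_cast
  rw [map_mul, map_mul]
  ring

/-- The `n`-sum of `S_j(·,𝐚₁₄)`:
`Σ_n a₁₄(drn)ξ₀ⱼ(n;d,r)n⁻¹ = χ(d)χ(r)·Σ_n χ(n)f̃(…)ξ₀ⱼ(n;d,r)n⁻¹`.
[cite: Zhang2022LandauSiegel, §10 p. 60] -/
theorem nSum_a14_eq (j d r : ℕ) :
    ∑ n ∈ Finset.Ico 1 (Nsupp D), a14 χ (d * r * n) * xiZero c' D j n d r / (n : ℂ) =
      χ (d : ZMod D) * χ (r : ZMod D) * nSum14 c' χ j d r := by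
  unfold nSum14 a14
  rw [Finset.mul_sum]
  refine Finset.sum_congr rfl fun n _ => ?_
  push_cast
  rw [map_mul, map_mul]
  ring

/-- **Z22:§10.u047 holds** [Z22 p.59, tex L3018]: the skeleton's `S_j(𝐚₁₄,𝐚₂₂)` (Prop. 7.1's
`S_j` at `𝐚₁ = 𝐚₁₄`, `𝐚₂ = 𝐚₂₂`) IS the displayed double sum `Σ_rΣ_d |χ(d)||μχ(r)|λ₀ⱼ(dr)/(drφ(r))
(Σ_m …)(Σ_n …)` — `χ` real, so the character factors `χ(drm)·conj χ(drn)` collapse to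
`|χ(d)||χ(r)|χ(m)χ(n)`; unconditional (no (A), every `D`, every real `χ`).
[cite: Zhang2022LandauSiegel, §10 p. 59] -/
theorem sjExpand1422_holds : SjExpand1422 c' := by
  refine ⟨0, fun D _ χ _ hq _ _ j _ => ?_⟩
  unfold Sj
  rw [Finset.sum_comm]
  refine Finset.sum_congr rfl fun r _ => Finset.sum_congr rfl fun d _ => ?_
  rw [mSum_a14_eq, nSum_a22_eq χ c' hq, term1422, ← prefactor_eq χ hq d r]
  ring

/-- `SjExpand1422` — `_holds` alias of `sjExpand1422_holds` above under the fact's exact name (appended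
2026-08-28, D-0026 bookkeeping: the proof term is the existing theorem of this file; no statement,
definition or attribute is edited; no new named fact; the ledger's debt table listed the fact
unproved). [cite: Zhang2022LandauSiegel, §10 p. 59] -/
theorem _root_.Literature.NumberTheory.LFunctions.Zhang2022.Typed.Sec10C.SjExpand1422_holds :
    SjExpand1422 c' :=
  _root_.Literature.NumberTheory.LFunctions.Zhang2022.Typed.Sec10C.sjExpand1422_holds (c' := c')

/-- **Z22:§10.u054 holds** [Z22 p.60, tex L3073]: the skeleton's `S_j(𝐚₁₂,𝐚₁₄)` IS the displayed
double sum `Σ_rΣ_d |χ(d)||μχ(r)|λ₀ⱼ(dr)/(drφ(r))(Σ_m χ(m)(ῑ₃ϰ₃(drm) + ῑ₄ϰ₂(drm))m^{−(1−β_j)})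
(Σ_n χ(n)f̃(log(drn)/log P + 0.004 − α̃)ξ₀ⱼ(n;d,r)n⁻¹)`; unconditional.
[cite: Zhang2022LandauSiegel, §10 p. 60] -/
theorem sjExpand1214_holds : SjExpand1214 c' := by
  refine ⟨0, fun D _ χ _ hq _ _ j _ => ?_⟩
  unfold Sj
  rw [Finset.sum_comm]
  refine Finset.sum_congr rfl fun r _ => Finset.sum_congr rfl fun d _ => ?_
  rw [mSum_a12_eq, nSum_a14_eq, term1214, ← prefactor_eq χ hq d r]
  ring

/-- `SjExpand1214` — `_holds` alias of `sjExpand1214_holds` above under the fact's exact name (appended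
2026-08-28, D-0026 bookkeeping: the proof term is the existing theorem of this file; no statement,
definition or attribute is edited; no new named fact; the ledger's debt table listed the fact
unproved). [cite: Zhang2022LandauSiegel, §10 p. 60] -/
theorem _root_.Literature.NumberTheory.LFunctions.Zhang2022.Typed.Sec10C.SjExpand1214_holds :
    SjExpand1214 c' :=
  _root_.Literature.NumberTheory.LFunctions.Zhang2022.Typed.Sec10C.sjExpand1214_holds (c' := c')

end D34Expand
section D34Split

variable (c' : ℝ) {D : ℕ} (χ : DirichletCharacter ℂ D)

omit χ in
/-- `P = exp 𝓛⁹ ≥ 1`. [cite: Zhang2022LandauSiegel, §2 (2.6)] -/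
theorem one_le_bigP (D : ℕ) : (1 : ℝ) ≤ bigP D :=
  Real.one_le_exp (pow_nonneg (Real.log_natCast_nonneg D) 9)

omit χ in
/-- `T = exp 𝓛^{1.1} ≥ 1`. [cite: Zhang2022LandauSiegel, §6 p. 30] -/
theorem one_le_bigT (D : ℕ) : (1 : ℝ) ≤ bigT D :=
  Real.one_le_exp (Real.rpow_nonneg (Real.log_natCast_nonneg D) _)

omit χ in
/-- `P₃ = P^{0.498} ≤ P^{0.5}`. [cite: Zhang2022LandauSiegel, §2 (2.21)] -/
theorem P3_le_sqrtP (D : ℕ) : Skeleton.P3 D ≤ bigP D ^ (0.5 : ℝ) :=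
  Real.rpow_le_rpow_of_exponent_le (one_le_bigP D) (by norm_num)

omit χ in
/-- `P₂ = P^{0.5}T^{−10} ≤ P^{0.5}`. [cite: Zhang2022LandauSiegel, §2 (2.21)] -/
theorem P2_le_sqrtP (D : ℕ) : Skeleton.P2 D ≤ bigP D ^ (0.5 : ℝ) :=
  div_le_self (Real.rpow_nonneg (le_trans zero_le_one (one_le_bigP D)) _)
    (one_le_pow₀ (one_le_bigT D))

omit χ in
/-- `ϰ₃(k) = 0` for `k ≥ P^{0.5}` (`ϰ₃` is supported on `k < P₃ = P^{0.498}`).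
[cite: Zhang2022LandauSiegel, §8 (8.6)] -/
theorem vk3_eq_zero_of_le {D k : ℕ} (hk : bigP D ^ (0.5 : ℝ) ≤ (k : ℝ)) : vk3 D k = 0 := by
  unfold vk3
  rw [if_neg (not_lt.mpr ((P3_le_sqrtP D).trans hk))]

omit χ in
/-- `ϰ₂(k) = 0` for `k ≥ P^{0.5}` (`ϰ₂` is supported on `k < P₂ = P^{0.5}T^{−10}`).
[cite: Zhang2022LandauSiegel, §8 (8.6)] -/
theorem vk2_eq_zero_of_le {D k : ℕ} (hk : bigP D ^ (0.5 : ℝ) ≤ (k : ℝ)) : vk2 D k = 0 := by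
  unfold vk2
  rw [if_neg (not_lt.mpr ((P2_le_sqrtP D).trans hk))]

omit χ in
/-- If `dr ≥ P^{0.5}` and `n ≥ 1` then `drn ≥ P^{0.5}`. [folklore] -/
private theorem sqrtP_le_mul {D d r n : ℕ} (h : bigP D ^ (0.5 : ℝ) ≤ ((d * r : ℕ) : ℝ)) (hn : 1 ≤ n) :
    bigP D ^ (0.5 : ℝ) ≤ ((d * r * n : ℕ) : ℝ) := by
  refine h.trans ?_
  have : ((d * r : ℕ) : ℝ) * 1 ≤ ((d * r : ℕ) : ℝ) * n :=
    mul_le_mul_of_nonneg_left (by exact_mod_cast hn) (Nat.cast_nonneg _)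
  push_cast at this ⊢
  linarith

/-- The `n`-sum of `S_j(𝐚₁₄,𝐚₂₂)` vanishes for `dr ≥ P^{0.5}` (both `ϰ₂(drn)`, `ϰ₃(drn)` vanish).
[cite: Zhang2022LandauSiegel, §10 p. 59] -/
theorem nSum22_eq_zero (j : ℕ) {d r : ℕ} (h : bigP D ^ (0.5 : ℝ) ≤ ((d * r : ℕ) : ℝ)) :
    nSum22 c' χ j d r = 0 := by
  unfold nSum22
  refine Finset.sum_eq_zero fun n hn => ?_
  have hn : 1 ≤ n := (Finset.mem_Ico.mp hn).1
  rw [vk3_eq_zero_of_le (sqrtP_le_mul h hn), vk2_eq_zero_of_le (sqrtP_le_mul h hn)]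
  simp

/-- The `m`-sum of `S_j(𝐚₁₂,𝐚₁₄)` vanishes for `dr ≥ P^{0.5}`. [cite: Zhang2022LandauSiegel, §10 p. 60] -/
theorem mSum12_eq_zero (j : ℕ) {d r : ℕ} (h : bigP D ^ (0.5 : ℝ) ≤ ((d * r : ℕ) : ℝ)) :
    mSum12 c' χ j d r = 0 := by
  unfold mSum12
  refine Finset.sum_eq_zero fun m hm => ?_
  have hm : 1 ≤ m := (Finset.mem_Ico.mp hm).1
  rw [vk3_eq_zero_of_le (sqrtP_le_mul h hm), vk2_eq_zero_of_le (sqrtP_le_mul h hm)]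
  simp

/-- `term1422` vanishes for `dr ≥ P^{0.5}`. [cite: Zhang2022LandauSiegel, §10 p. 59] -/
theorem term1422_eq_zero (j : ℕ) {d r : ℕ} (h : bigP D ^ (0.5 : ℝ) ≤ ((d * r : ℕ) : ℝ)) :
    term1422 c' χ j d r = 0 := by
  rw [term1422, nSum22_eq_zero c' χ j h, mul_zero]

/-- `term1214` vanishes for `dr ≥ P^{0.5}`. [cite: Zhang2022LandauSiegel, §10 p. 60] -/
theorem term1214_eq_zero (j : ℕ) {d r : ℕ} (h : bigP D ^ (0.5 : ℝ) ≤ ((d * r : ℕ) : ℝ)) :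
    term1214 c' χ j d r = 0 := by
  rw [term1214, mSum12_eq_zero c' χ j h, mul_zero, zero_mul]

omit χ in
/-- The three-window bookkeeping: for `x ≥ 0` and a quantity `t` that vanishes when `x ≥ P^{0.5}`,
`t = [x < P^{0.496}]t + [P^{0.496} ≤ x < P^{0.498}]t + [P^{0.498} ≤ x < P^{0.5}]t`.
[cite: Zhang2022LandauSiegel, §10 p. 59] -/
theorem split_three (D : ℕ) {x : ℝ} (hx : 0 ≤ x) (t : ℂ) (ht : bigP D ^ (0.5 : ℝ) ≤ x → t = 0) :
    t = (if (0 : ℝ) ≤ x ∧ x < bigP D ^ (0.496 : ℝ) then t else 0) +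
        (if bigP D ^ (0.496 : ℝ) ≤ x ∧ x < bigP D ^ (0.498 : ℝ) then t else 0) +
        (if bigP D ^ (0.498 : ℝ) ≤ x ∧ x < bigP D ^ (0.5 : ℝ) then t else 0) := by
  have hP := one_le_bigP D
  have h68 : bigP D ^ (0.496 : ℝ) ≤ bigP D ^ (0.498 : ℝ) :=
    Real.rpow_le_rpow_of_exponent_le hP (by norm_num)
  have h80 : bigP D ^ (0.498 : ℝ) ≤ bigP D ^ (0.5 : ℝ) :=
    Real.rpow_le_rpow_of_exponent_le hP (by norm_num)
  by_cases h1 : x < bigP D ^ (0.496 : ℝ)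
  · rw [if_pos ⟨hx, h1⟩, if_neg (fun h => (not_le.mpr h1) h.1),
      if_neg (fun h => (not_le.mpr (h1.trans_le h68)) h.1)]
    ring
  rw [not_lt] at h1
  by_cases h2 : x < bigP D ^ (0.498 : ℝ)
  · rw [if_neg (fun h => (not_lt.mpr h1) h.2), if_pos ⟨h1, h2⟩,
      if_neg (fun h => (not_le.mpr h2) h.1)]
    ring
  rw [not_lt] at h2
  by_cases h3 : x < bigP D ^ (0.5 : ℝ)
  · rw [if_neg (fun h => (not_lt.mpr h1) h.2), if_neg (fun h => (not_lt.mpr h2) h.2),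
      if_pos ⟨h2, h3⟩]
    ring
  rw [not_lt] at h3
  rw [if_neg (fun h => (not_lt.mpr h1) h.2), if_neg (fun h => (not_lt.mpr h2) h.2),
    if_neg (fun h => (not_lt.mpr h3) h.2), ht h3]
  ring

/-- **Z22:§10.u048 holds** [Z22 p.59, tex L3025]: "The right side is split into three sums according
to `dr < P^{0.496}`, `P^{0.496} ≤ dr < P^{0.498}`, `P^{0.498} ≤ dr < P^{0.5}`" — the three windows
exhaust the double sum because the `(d,r)`-terms with `dr ≥ P^{0.5}` vanish (`ϰ₂`, `ϰ₃` are supported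
below `P₂ = P^{0.5}T^{-10} ≤ P^{0.5}`, `P₃ = P^{0.498} ≤ P^{0.5}`); unconditional.
[cite: Zhang2022LandauSiegel, §10 p. 59] -/
theorem split1422_holds : Split1422 c' := by
  refine ⟨0, fun D _ χ _ _ _ _ j _ => ?_⟩
  unfold S1422On
  rw [← Finset.sum_add_distrib, ← Finset.sum_add_distrib]
  refine Finset.sum_congr rfl fun r _ => ?_
  rw [← Finset.sum_add_distrib, ← Finset.sum_add_distrib]
  refine Finset.sum_congr rfl fun d _ => ?_
  exact split_three D (Nat.cast_nonneg _) _ (term1422_eq_zero c' χ j)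

/-- `Split1422` — `_holds` alias of `split1422_holds` above under the fact's exact name (appended
2026-08-28, D-0026 bookkeeping: the proof term is the existing theorem of this file; no statement,
definition or attribute is edited; no new named fact; the ledger's debt table listed the fact
unproved). [cite: Zhang2022LandauSiegel, §10 p. 59] -/
theorem _root_.Literature.NumberTheory.LFunctions.Zhang2022.Typed.Sec10C.Split1422_holds :
    Split1422 c' :=
  _root_.Literature.NumberTheory.LFunctions.Zhang2022.Typed.Sec10C.split1422_holds (c' := c')

/-- **Z22:§10.u055 (split) holds** [Z22 p.60, tex L3079]: "The right side is split into three sums in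
the same way as in the last subsection" — for `S_j(𝐚₁₂,𝐚₁₄)` the `(d,r)`-terms with `dr ≥ P^{0.5}`
vanish through the `m`-sum (`ϰ₃(drm)`, `ϰ₂(drm)`); unconditional. [cite: Zhang2022LandauSiegel, §10 p. 60] -/
theorem split1214_holds : Split1214 c' := by
  refine ⟨0, fun D _ χ _ _ _ _ j _ => ?_⟩
  unfold S1214On
  rw [← Finset.sum_add_distrib, ← Finset.sum_add_distrib]
  refine Finset.sum_congr rfl fun r _ => ?_
  rw [← Finset.sum_add_distrib, ← Finset.sum_add_distrib]
  refine Finset.sum_congr rfl fun d _ => ?_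
  exact split_three D (Nat.cast_nonneg _) _ (term1214_eq_zero c' χ j)

/-- `Split1214` — `_holds` alias of `split1214_holds` above under the fact's exact name (appended
2026-08-28, D-0026 bookkeeping: the proof term is the existing theorem of this file; no statement,
definition or attribute is edited; no new named fact; the ledger's debt table listed the fact
unproved). [cite: Zhang2022LandauSiegel, §10 p. 60] -/
theorem _root_.Literature.NumberTheory.LFunctions.Zhang2022.Typed.Sec10C.Split1214_holds :
    Split1214 c' :=
  _root_.Literature.NumberTheory.LFunctions.Zhang2022.Typed.Sec10C.split1214_holds (c' := c')

end D34Split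

end Literature.NumberTheory.LFunctions.Zhang2022.Typed.Sec10C
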